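import Summits.NavierStokesRegularity.FluidComputer.PalasekTowerEpisodes
import Literature.Analysis.FluidPDE.KelvinCirculationForced

/-!
# A candidate registered margin for the episode split: the Kelvin ledger

Cell `ns-blowup`, seat `ns-blowup-ecbridge-1`; companion of `PalasekTowerEpisodes.lean` (ROUTE-BRIEF
v1.1 (P2): ONE margin set shared by K1/K2, registered before filing). LABEL: E-C typing; WHAT THIS IS
NOT: not Navier–Stokes evidence — a predicate. The margin is written in the vocabulary of the
catalogued barrier `Literature.Barriers.NavierStokesRegularity.PalasekTowerKelvinCeiling`
(circulations of material images of label loops under a particle-trajectory map), so that the Kelvin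
content of the induction step K2 is explicit: by the forced Kelvin identity
`Literature.Analysis.FluidPDE.IsClassicalNSSolutionOn.circulation_sub_eq_integral` the circulation of
level `k+1`'s loop can grow from its scheduled value `Φ_{k+1}` to the core value `c₁ N_{k+1}^{β-2}`
only through PRE-LOADING (the loop already threads `≍ N_k^{(b-1)(β-2)}` host fluxes — the bundling
evasion ¬(H-single), a design burden carried by every stage) or through the viscous budget
¬(H-budget). [cite: Palasek2026ElementaryModel, §3.1 (3.2)] [cite: MajdaBertozziCUP2002, §1.6 Prop. 1.11]
-/

noncomputable section

namespace Summit.NavierStokesRegularity.FluidComputer.PalasekTowerClayBridge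

open Set MeasureTheory Filter Topology Function
open scoped ENNReal ContDiff NNReal
open Literature.Analysis.FluidPDE

/-- **Candidate registered margin: the KELVIN LEDGER** (typed in the vocabulary of the catalogued
barrier `Literature.Barriers.NavierStokesRegularity.PalasekTowerKelvinCeiling`). At stage `k` there is
a particle-trajectory map `X` of `u` on `[0, τ k]` (`∂ₜX = u(t, X)`, `X(0) = id`) such that (i) every
grown level `j ≤ k` carries the dictionary's core circulation at its readout,
`c₁ N_j^{β-2} ≤ ∮_{X(τ j)∘loop j} u(τ j)·dℓ` (the barrier's (H-core)), and (ii) every dormant loop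
`j ≥ k+1` keeps its scheduled circulation `Φ_j` within a factor on `[0, τ k]`. Under this margin the
induction step K2 must make `∮ u·dℓ` around the material image of `loop (k+1)` grow from `≈ Φ_{k+1}`
to `≥ c₁ N_{k+1}^{β-2}`; by the forced Kelvin identity
(`IsClassicalNSSolutionOn.circulation_sub_eq_integral`) that growth equals `∫∮(νΔu + f)·dℓ` — so
either `Φ_{k+1}` is PRE-LOADED (the loop already threads `≍ N_k^{(b-1)(β-2)}` host fluxes: the
bundling evasion ¬(H-single), a burden on the design at every stage) or the step PRODUCES the
viscous budget ¬(H-budget). Either way the Kelvin content of the crux is explicit, which is the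
point of registering this margin (ROUTE-BRIEF §3 BC8). A CANDIDATE; the cell registers its margin
set before filing (P2). [cite: Palasek2026ElementaryModel, §3.1 (3.2)] -/
def Margins.kelvinLedger (R : TowerRates) : Margins R := fun S k u =>
  ∃ X : ℝ → EuclideanSpace ℝ (Fin 3) → EuclideanSpace ℝ (Fin 3),
    IsSmoothSpaceTimeOn (Icc 0 (S.τ k)) X ∧
    (∀ t ∈ Icc 0 (S.τ k), ∀ a,
      HasDerivWithinAt (fun s => X s a) (u t (X t a)) (Icc 0 (S.τ k)) t) ∧
    (∀ a, X 0 a = a) ∧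
    (∀ j, j ≤ k → S.c₁ * R.N j ^ (R.β - 2) ≤ circulation (u (S.τ j)) (X (S.τ j) ∘ S.loop j)) ∧
    (∀ j, k + 1 ≤ j → ∀ t ∈ Icc 0 (S.τ k),
      |circulation (u t) (X t ∘ S.loop j) - S.Φ j| ≤ S.Φ j / 2)


end Summit.NavierStokesRegularity.FluidComputer.PalasekTowerClayBridge

end
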